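import Literature.NumberTheory.Automorphic.TwistedQuotientLevelChangeNilpotent
import Literature.NumberTheory.Automorphic.BigHeckePolynomialBridge
import Literature.NumberTheory.Automorphic.TameLevelTowerLevelChange
import Literature.NumberTheory.Automorphic.ArithmeticQuotientTwistedComparison
import Literature.Algebra.Homology.GroupCohomologyRetract
import HarnessLib

/-!
# Hecke operators vanishing in the big Hecke algebra act nilpotently on `H^q(X_U, W^{U/U_r})`

Topic `NumberTheory/Automorphic`; namespace `Literature.NumberTheory.Automorphic`, grouping
sub-namespaces `ArithmeticQuotient` and `BigHeckeGLn.TameLevel`.  Definitions with bodies and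
theorems; no named fact.  This file assembles, for the tame level datum `𝒰 : TameLevel n K p` of
`GL_n` over a number field `K` and its `p`-power tower `U_r = 𝒰.tower r ≤ U = 𝒰.subgroup`, the
Hochschild–Serre / level-change step of [Scholze2015, §V.4, proof of Thm. V.4.1 and of Cor. V.4.2]:

* `map_id_eq_zero_iff_of_iso`: vanishing of `Hⁿ(G, P)` is invariant under conjugating `P` by an
  isomorphism of coefficients (generic);
* `ArithmeticQuotient.heckePoly_comp_coeffHom`, **`ArithmeticQuotient.map_heckePoly_eq_zero_of_free`**:
  a noncommutative polynomial `Q` in Hecke operators `[L tᵢ L]` killing `Hᵇ(X_L, k)` kills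
  `Hᵇ(X_L, N)` for every finite free `k`-module `N` ("`ℳ_{ξ,K}/p^m` is a direct sum of copies of
  `ℤ/p^m`", loc. cit.; `map_id_eq_zero_of_retract` with coordinates / basis vectors);
* `ArithmeticQuotient.heckePoly_comp_coeffRepIsoTwisted_hom`, `map_heckePoly_eq_zero_iff_twisted`:
  passage to the `TwistedQuotient` model with trivial twist;
* `BigHeckeGLn.TameLevel.towerProdTwist 𝒰 r σ`: the representation
  `W = Fun(GL_n(𝔸_K^∞)/U_r, N)` of `GL_n(K) × (U ⧸ U_r)` with values twisted by a representation
  `σ` of `U ⧸ U_r` on `N` (`TwistedQuotient.levelProdTwist` with `ρ = 1`; in the application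
  `N = M_ξ/p^s` and `σ` is the reduction of the algebraic representation on a stable lattice), the
  hypotheses `hconj` for the spherical elements `t_{w,i}` (`exists_conj_heckeElement_eq`) and for
  central elements, and
* **`BigHeckeGLn.TameLevel.pow_succ_map_φZ_heckePolyTwist_eq_zero_of_heckeOperator`**: if `Q`
  evaluated at the families `𝒰.heckeOperator tⱼ ∈ ∏ End(Hⁱ(X_{U_r}, ℤ/p^s))` vanishes in the
  factors `(r, s, b)`, `b ≤ q` (a basic neighbourhood of `0` in `𝕋(K^p)`), then `Q` evaluated at
  the `[U_r tⱼ U_r]` acting on `W^{U/U_r} = {f | σ(u) f(c u) = f(c)}` acts on `H^q(GL_n K, W^{U/U_r})`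
  with `(q+1)`-st power zero.

## References

* P. Scholze, Ann. of Math. 182 (2015), §V.4, proof of Thm. V.4.1 and of Cor. V.4.2 [Scholze2015].
* M. Emerton, Invent. Math. 164 (2006), §2.2 [Emerton2006].
-/

noncomputable section

open CategoryTheory groupCohomology IsDedekindDomain Literature.Algebra.Homology
open scoped NumberField

namespace Literature.NumberTheory.Automorphic

/-! ### Vanishing of `Hⁿ(G, P)` is invariant under isomorphisms of coefficients -/

section Generic

universe u

variable {k G : Type u} [CommRing k] [Group G] {A B : Rep k G}

/-- If `P ∈ End A` and `P' ∈ End B` are intertwined by an isomorphism `e : A ≅ B`, then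
`Hⁿ(G, P) = 0 ↔ Hⁿ(G, P') = 0`. [folklore] -/
theorem map_id_eq_zero_iff_of_iso (e : A ≅ B) {P : A ⟶ A} {P' : B ⟶ B}
    (h : P ≫ e.hom = e.hom ≫ P') (n : ℕ) :
    groupCohomology.map (MonoidHom.id G) P n = 0 ↔
      groupCohomology.map (MonoidHom.id G) P' n = 0 := by
  have hP' : P' = e.inv ≫ P ≫ e.hom := by rw [h, Iso.inv_hom_id_assoc]
  have hP : P = e.hom ≫ P' ≫ e.inv := by
    rw [← Category.assoc, ← h, Category.assoc, Iso.hom_inv_id, Category.comp_id]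
  constructor
  · intro h0
    rw [hP', groupCohomology.map_id_comp, groupCohomology.map_id_comp, h0, Limits.zero_comp,
      Limits.comp_zero]
  · intro h0
    rw [hP, groupCohomology.map_id_comp, groupCohomology.map_id_comp, h0, Limits.zero_comp,
      Limits.comp_zero]

end Generic

/-! ### Constant coefficients: from `k` to a finite free `k`-module, and to the twisted model -/

namespace ArithmeticQuotient

universe u

variable (k : Type u) [CommRing k] {Γ 𝒢 : Type u} [Group Γ] [Group 𝒢] (ι : Γ →* 𝒢)
  (L : Subgroup 𝒢) {M : Type u} [AddCommGroup M] [Module k M] {M' : Type u} [AddCommGroup M']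
  [Module k M'] {I : Type*} (t : I → 𝒢)

/-- A polynomial in the `[L tᵢ L]` commutes with every change of coefficients `φ : M → M'`
(`heckeRepHom_comp_coeffHom` on generators). [folklore] -/
theorem heckePoly_comp_coeffHom (φ : M →ₗ[k] M') (Q : FreeRing I) :
    heckePoly k ι L M t Q ≫ coeffHom ι L φ = coeffHom ι L φ ≫ heckePoly k ι L M' t Q :=
  freeRingLift_comp_hom _ _ _ (fun i => by
    rw [heckePoly_of, heckePoly_of]
    exact heckeRepHom_comp_coeffHom (L := L) (g := t i) (ι := ι) φ) Q

variable (M) in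
/-- **From `k` to a finite free `k`-module of coefficients**: if a polynomial `Q` in the Hecke
operators `[L tᵢ L]` acts as `0` on `Hᵇ(X_L, k)`, it acts as `0` on `Hᵇ(X_L, M)` for `M` finite
free over `k` (`M ≅ kᵈ`: `Fun(𝒢 ⧸ L, M)` is a retract — indeed a direct sum — of copies of
`Fun(𝒢 ⧸ L, k)` compatibly with the Hecke operators). [cite: Scholze2015, §V.4, proof of Thm. V.4.1] -/
theorem map_heckePoly_eq_zero_of_free [Module.Finite k M] [Module.Free k M] (Q : FreeRing I)
    (b : ℕ) (h : groupCohomology.map (A := coeffRep k ι L k) (MonoidHom.id Γ)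
      (heckePoly k ι L k t Q) b = 0) :
    groupCohomology.map (A := coeffRep k ι L M) (MonoidHom.id Γ) (heckePoly k ι L M t Q) b = 0 := by
  let bs := Module.Free.chooseBasis k M
  refine map_id_eq_zero_of_retract (ι := Module.Free.ChooseBasisIndex k M)
    (fun i => coeffHom ι L (bs.coord i)) (fun i => coeffHom ι L (LinearMap.toSpanSingleton k M (bs i)))
    ?_ (fun i => heckePoly_comp_coeffHom k ι L t (bs.coord i) Q) b h
  refine Rep.hom_ext (Representation.IntertwiningMap.ext (LinearMap.ext fun f => funext fun c => ?_))
  change (∑ i, coeffHom ι L (bs.coord i) ≫ coeffHom ι L (LinearMap.toSpanSingleton k M (bs i))).hom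
    f c = f c
  rw [Rep.sum_hom, Representation.IntertwiningMap.sum_apply, Finset.sum_apply]
  change ∑ i, bs.coord i (f c) • bs i = f c
  exact bs.sum_repr (f c)

variable (M)

/-- Polynomials in Hecke operators match under `coeffRepIsoTwisted`. [folklore] -/
theorem heckePoly_comp_coeffRepIsoTwisted_hom (Q : FreeRing I) :
    heckePoly k ι L M t Q ≫ (coeffRepIsoTwisted k ι L M).hom =
      (coeffRepIsoTwisted k ι L M).hom ≫
        TwistedQuotient.heckePoly ι L (1 : Representation k Γ M) t Q :=
  freeRingLift_comp_hom _ _ _ (fun i => by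
    rw [heckePoly_of, TwistedQuotient.heckePoly_of]
    exact heckeRepHom_comp_coeffRepIsoTwisted k ι L M (t i)) Q

/-- Vanishing of `Hᵇ` of a polynomial in Hecke operators is the same in the untwisted model and in
the twisted model with trivial twist. [folklore] -/
theorem map_heckePoly_eq_zero_iff_twisted (Q : FreeRing I) (b : ℕ) :
    groupCohomology.map (A := coeffRep k ι L M) (MonoidHom.id Γ) (heckePoly k ι L M t Q) b = 0 ↔
      groupCohomology.map (A := TwistedQuotient.coeffRep ι L (1 : Representation k Γ M))
        (MonoidHom.id Γ) (TwistedQuotient.heckePoly ι L (1 : Representation k Γ M) t Q) b = 0 :=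
  map_id_eq_zero_iff_of_iso (coeffRepIsoTwisted k ι L M)
    (heckePoly_comp_coeffRepIsoTwisted_hom k ι L M t Q) b

end ArithmeticQuotient

/-! ### The tame level: `W = Fun(GL_n(𝔸_K^∞)/U_r, N)` with values twisted by `U ⧸ U_r` -/

namespace BigHeckeGLn

namespace TameLevel

variable {n : ℕ} {K : Type} [Field K] [NumberField K] {p : ℕ} [Fact p.Prime]
  (𝒰 : TameLevel n K p) (r : ℕ)

/-- `hconj` for the spherical elements: `u t_{w,i} u⁻¹ ∈ U_r t_{w,i} U_r` for `u ∈ U`, `w ∉ S`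
(`exists_conj_heckeElement_eq`). [folklore] -/
theorem hconj_heckeElement {w : HeightOneSpectrum (𝓞 K)} (hw : w ∉ 𝒰.bad) (i : ℕ)
    (u : 𝒰.subgroup) :
    ∃ a ∈ 𝒰.tower r, ∃ b ∈ 𝒰.tower r,
      (u : FiniteAdelicGL n K) * heckeElement n K w i * (u : FiniteAdelicGL n K)⁻¹ =
        a * heckeElement n K w i * b :=
  exists_conj_heckeElement_eq hw i r u

/-- `hconj` for central elements (e.g. `t_{w,n}⁻¹ = ϖ_w⁻¹ · 1`): `u z u⁻¹ = z`. [folklore] -/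
theorem hconj_of_mem_center {z : FiniteAdelicGL n K} (hz : z ∈ Subgroup.center (FiniteAdelicGL n K))
    (u : 𝒰.subgroup) :
    ∃ a ∈ 𝒰.tower r, ∃ b ∈ 𝒰.tower r,
      (u : FiniteAdelicGL n K) * z * (u : FiniteAdelicGL n K)⁻¹ = a * z * b :=
  ⟨1, one_mem _, 1, one_mem _, by
    rw [one_mul, mul_one, Subgroup.mem_center_iff.1 hz (u : FiniteAdelicGL n K),
      mul_inv_cancel_right]⟩

variable {k : Type} [CommRing k] {N : Type} [AddCommGroup N] [Module k N]
  (σ : Representation k (𝒰.subgroup ⧸ (𝒰.tower r).subgroupOf 𝒰.subgroup) N)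

/-- The trivial `GL_n(K)`-action on the values commutes with `σ`. [folklore] -/
theorem commute_one_apply (γ : GL (Fin n) K) (h : 𝒰.subgroup ⧸ (𝒰.tower r).subgroupOf 𝒰.subgroup) :
    Commute ((1 : Representation k (GL (Fin n) K) N) γ) (σ h) :=
  Commute.one_left _

/-- **`W = Fun(GL_n(𝔸_K^∞)/U_r, N)` as a representation of `GL_n(K) × (U ⧸ U_r)`** — `GL_n(K)`
by left translation, `U ⧸ U_r` by right translation twisted by `σ` on the values:
`((γ, u) f)(c) = σ(u) f(γ⁻¹ c u)` (`TwistedQuotient.levelProdTwist` with `ρ = 1`; in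
[Scholze2015, §V.4, proof of Thm. V.4.1]: `N = M_ξ/p^m`, `σ` the action of `K_p` on it).
[cite: Scholze2015, §V.4, proof of Thm. V.4.1] -/
abbrev towerProdTwist :
    Rep k (GL (Fin n) K × (𝒰.subgroup ⧸ (𝒰.tower r).subgroupOf 𝒰.subgroup)) :=
  TwistedQuotient.levelProdTwist (globalEmbedding n K) (𝒰.tower_le r)
    (1 : Representation k (GL (Fin n) K) N) σ (commute_one_apply 𝒰 r σ)

variable {I : Type*} (t : I → FiniteAdelicGL n K)
  (hconjₜ : ∀ (i : I) (u : 𝒰.subgroup), ∃ a ∈ 𝒰.tower r, ∃ b ∈ 𝒰.tower r,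
    (u : FiniteAdelicGL n K) * t i * (u : FiniteAdelicGL n K)⁻¹ = a * t i * b)

/-- Evaluation of noncommutative polynomials at the Hecke operators `[U_r tᵢ U_r]` acting on `W`
(`TwistedQuotient.heckePolyTwist`; `U_r tᵢ U_r / U_r` is finite as `U_r` is compact open). [folklore] -/
abbrev heckePolyTower : FreeRing I →+* End (towerProdTwist 𝒰 r σ) :=
  TwistedQuotient.heckePolyTwist (globalEmbedding n K) (𝒰.tower_le r)
    (1 : Representation k (GL (Fin n) K) N) σ (commute_one_apply 𝒰 r σ) t hconjₜ
    fun i => finite_doubleCosetQuot_tower r (t i)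

/-- **Hecke operators vanishing in the big Hecke algebra act nilpotently on
`H^q(GL_n K, W^{U/U_r})`.**  Let `N` be a finite free `ℤ/p^s`-module with an action `σ` of
`U ⧸ U_r`, `W = Fun(GL_n(𝔸_K^∞)/U_r, N)` (`towerProdTwist`), and `Q` a noncommutative polynomial
in generators `tⱼ ∈ GL_n(𝔸_K^∞)` with `u tⱼ u⁻¹ ∈ U_r tⱼ U_r` for `u ∈ U` (the spherical `t_{w,i}`,
`w ∉ S`, and the central `t_{w,n}⁻¹`: `hconj_heckeElement`, `hconj_of_mem_center`).  If `Q`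
evaluated at the families `𝒰.heckeOperator tⱼ ∈ ∏_{(r,s,i)} End(Hⁱ(X_{U_r}, ℤ/p^s))` — an element
of the subring whose closure is `𝕋(K^p)` — vanishes in the factors `(r, s, b)` for all `b ≤ q`,
then `Q` evaluated at the `[U_r tⱼ U_r]` on `W^{U/U_r} = {f | σ(u) f(c u) = f(c)}`
(`φZ _ _ 0` on `hKerRep _ 0`, `TwistedQuotient.mem_hKer_levelProdTwist_iff`) acts on
`H^q(GL_n K, W^{U/U_r})` with `(q+1)`-st power zero.  This is the Hochschild–Serre step
`Hⁱ(K/K', Hʲ(X_{K'}, ℳ_{ξ,K'}/p^m)) ⇒ H^{i+j}(X_K, ℳ_{ξ,K}/p^m)` of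
[cite: Scholze2015, §V.4, proof of Thm. V.4.1] combined with "`ℳ_{ξ,K'}/p^m` is a direct sum of
copies of `ℤ/p^m`", in the form used in the proof of [Scholze2015, Cor. V.4.2]. -/
theorem pow_succ_map_φZ_heckePolyTower_eq_zero_of_heckeOperator {s : ℕ} {N : Type}
    [AddCommGroup N] [Module (ZMod (p ^ s)) N] [Module.Finite (ZMod (p ^ s)) N]
    [Module.Free (ZMod (p ^ s)) N]
    (σ : Representation (ZMod (p ^ s)) (𝒰.subgroup ⧸ (𝒰.tower r).subgroupOf 𝒰.subgroup) N)
    (Q : FreeRing I) (q : ℕ)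
    (hQ : ∀ b ≤ q, FreeRing.lift (fun j => 𝒰.heckeOperator (t j)) Q (r, s, b) = 0) :
    (groupCohomology.map (A := hKerRep (towerProdTwist 𝒰 r σ) 0) (MonoidHom.id (GL (Fin n) K))
      (φZ (towerProdTwist 𝒰 r σ) (heckePolyTower 𝒰 r σ t hconjₜ Q) 0) q).hom ^ (q + 1) = 0 :=
  TwistedQuotient.pow_succ_map_φZ_heckePolyTwist_eq_zero (globalEmbedding n K) (𝒰.tower_le r)
    (1 : Representation (ZMod (p ^ s)) (GL (Fin n) K) N) σ (commute_one_apply 𝒰 r σ) t hconjₜ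
    (fun i => finite_doubleCosetQuot_tower r (t i)) Q q fun b hb =>
      (ArithmeticQuotient.map_heckePoly_eq_zero_iff_twisted (ZMod (p ^ s)) (globalEmbedding n K)
        (𝒰.tower r) N t Q b).1
        (ArithmeticQuotient.map_heckePoly_eq_zero_of_free (ZMod (p ^ s)) (globalEmbedding n K)
          (𝒰.tower r) N t Q b
          ((freeRingLift_heckeOperator_apply_eq_zero_iff 𝒰 t Q r s b).1 (hQ b hb)))

end TameLevel

end BigHeckeGLn

end Literature.NumberTheory.Automorphic
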